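import Literature.AlgebraicGeometry.Resolution.HypersurfaceRestriction
import Literature.AlgebraicGeometry.Resolution.HypersurfacePushforward
import Literature.AlgebraicGeometry.Resolution.ExceptionalDivisorRegularGlobal
import Literature.AlgebraicGeometry.Resolution.RegularBlowup
import Literature.AlgebraicGeometry.Resolution.BlowupSNC
import Literature.AlgebraicGeometry.Resolution.StrictTransformDistinct
import Literature.AlgebraicGeometry.Resolution.CanonicalResolutionSmoothCentre
import Literature.AlgebraicGeometry.Resolution.RegularLocalRingsJacobian
import Literature.AlgebraicGeometry.Resolution.RegularLocalRingsProofs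
import Literature.AlgebraicGeometry.Resolution.BlowupsIntegral
import Literature.AlgebraicGeometry.Resolution.BlowupChartMembership
import Summits.ResolutionOfSingularities.ResolutionOfSingularities.Theorems.EquisingularLiftEquisingularLiftNatStrictTransformCentre
import Summits.ResolutionOfSingularities.ResolutionOfSingularities.Theorems.EquisingularLiftEquisingularLiftNatTraceIso
import Summits.ResolutionOfSingularities.ResolutionOfSingularities.Theorems.EquisingularLiftEquisingularLiftSectionKer
import Mathlib.RingTheory.Noetherian.UniqueFactorizationDomain
import Mathlib.RingTheory.UniqueFactorizationDomain.Multiplicity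
import HarnessLib

/-!
# [OURS · L1 W4.5(b) · EL♮(3)] K7d — the carrier pair after a blow-up in a regular centre: `St(𝓢)` has REGULAR `V(·)`,
# `St(𝓢)` and `St(K)` stay STALKWISE PRINCIPAL (clause (iii) of `TCPlus.Member` carried along an in-carrier section step)

Crux `EquisingularLiftNatThree` = stmt-ResolutionOfSingularities-20148 (parent `EquisingularLiftNat` = stmt-20038), route
`EquisingularLift`, line `sections`; registered rung stub `stub_elnat_tcPlusPointResolution` (skeleton v9 / child v6,
res-L1-w45b-lead-2). Helper file `--supports stmt-ResolutionOfSingularities-20148 --as helper` by res-D-pv-032: brick **K7d** of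
res-L1-w45b-stub-1's HSUB(ReachTC⁺)₃ assembly (BRICK DEAL 2026-08-27T11:31:42Z, DEAL RULING 11:40:57Z «K7d → res-D-pv-032»).
HONEST FRAMING: OURS (cell res-hironaka, slot W4.5(b)); NOT a statement of any manuscript; AI-written, weaker than expert
review. No `sorry`; standard axioms.

WHERE IT SITS. In the inner chain of the supplier HSUB′(ReachTC⁺)₃ (driver `hsub_reachTCPlus_of_invariant`, p526242) the
upstairs stage `X` carries an IN-CARRIER PAIR `(𝓢, K)` of ideal sheaves (clause (iii) of `TCPlus.Member`, draft
`L/res-L1-w45b-stub-1/SubchainSupplierInvDefs.lean`: `Scheme.IsRegular 𝓢.subscheme ∧ ∀ z, (stalkIdeal 𝓢 z).IsPrincipal ∧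
(stalkIdeal K z).IsPrincipal`), and a step blows `X` up along a section `s` with `𝓢 ⊔ K ≤ s.ker` (K7 = the point step at an
in-carrier section, res-L1-w45b-stub-1 11:27:45Z / 11:31:42Z). This file supplies clause (iii) for the new pair
`(St_τ 𝓢, St_τ K)` on the blow-up `X′`, for ANY blow-up `τ` of a regular, integral, locally Noetherian `X` along a centre `C` with
`V(C)` regular (a section `s : Spec O → X` is the case `C = s.ker`, `V(C) ≅ Spec O`):

* `isPrincipal_iSup_colon_span_singleton_pow` — ring lemma: in a domain with the ascending chain condition on principal
  ideals, for a PRIME element `t` and any `g` the saturation `⋃ₙ ((g) : tⁿ)` is principal (`g = tᵐ·h`, `t ∤ h` ⇒ it is `(h)`);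
* `prime_of_stalkIdeal_exceptional_eq_span` — the stalk `(C·𝒪_{X′})_{z′} = (t)` of the exceptional ideal at a point of
  the exceptional divisor `E` is generated by a PRIME element: `𝒪_{X′,z′}/(t)` is the local ring of `E`, regular by Liu 8.1.19 (b)
  (tree `IsBlowup.isRegular_subscheme_comap`), hence a domain;
* **`isPrincipal_stalkIdeal_strictTransformIdeal`** — the strict transform `St_τ K = ⋃ₙ (τ^*K : 𝓘(E)ⁿ)` of a STALKWISE
  PRINCIPAL ideal sheaf `K` is stalkwise principal (off `E` it is the total transform; on `E` the ring lemma);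
* `exists_generator_not_mem_sq_of_isRegular_subscheme` — clause (iii) ⇒ the tree's «regular hypersurface» form: at every
  point of `V(𝓢)` the stalk `𝓢_x` is generated by an element of order one (`𝒪_{X,x}/(v)` regular with `v ≠ 0` forces
  `v ∉ 𝔪²`, tree `not_isRegularLocalRing_quotient_span_singleton_of_mem_sq`, Matsumura 14.2);
* **`isRegular_subscheme_strictTransformIdeal_of_le`** — for `𝓢 ≤ C` with `V(𝓢)` regular, `𝓢` stalkwise principal and
  `𝓢 ≠ ⊥`: `V(St_τ 𝓢)` is REGULAR — `St_τ 𝓢` is the controlled transform `(τ^*𝓢 : 𝓘(E))` (tree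
  `IsBlowup.strictTransformIdeal_eq_controlledTransform_of_hypersurface`, GW 13.96 (2)), `V(St_τ 𝓢) → V(𝓢)` is a blow-up of
  the regular `V(𝓢)` along `C·𝒪_{V(𝓢)}` (restriction property, tree `IsBlowup.isBlowup_subscheme_controlledTransform`) whose
  centre `V(C·𝒪_{V(𝓢)}) ≅ V(𝓢·𝒪_{V(C)}) = V(C)` is regular (`𝓢 ≤ C`), so Liu 8.1.19 (a) (tree
  `IsBlowup.isRegular_of_isRegular_subscheme`) applies;
* `strictTransformIdeal_ne_bot` — `St_τ 𝓢 ≠ ⊥` (so the lemma chains along the inner induction);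
* **`member_clause_iii_strictTransform`** — the package: clause (iii) for `(𝓢, K)`, `𝓢 ≤ C`, `𝓢 ≠ ⊥` ⊢ clause (iii) VERBATIM for
  `(St_τ 𝓢, St_τ K)` on `X′` and `St_τ 𝓢 ≠ ⊥`; `member_clause_iii_strictTransform_section` — the same at `C := s.ker` for a
  section `s` of a morphism `X → Spec O` (`O` a regular local ring, e.g. a DVR), from `𝓢 ⊔ K ≤ s.ker`.

References: Q. Liu, *Algebraic Geometry and Arithmetic Curves* (2002), Thm. 8.1.19 (a),(b); U. Görtz, T. Wedhorn,
*Algebraic Geometry I* (2020), Prop. 13.91, 13.96 (2); H. Matsumura, *Commutative Ring Theory* (1986), Thm. 14.2, 14.3.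
Tree inputs by name: `stalkIdeal_strictTransformIdeal` (BlowupSNC), `stalkIdeal_strictTransformIdeal_of_not_mem`
(StrictTransformDistinct), `IsEffectiveCartier.exists_stalkIdeal_eq_span` (BlowupChartMembership),
`isRegularLocalRing_stalk_quotient_stalkIdeal` (CanonicalResolutionSmoothCentre), `exists_hom_subscheme_controlledTransform` /
`IsBlowup.isBlowup_subscheme_controlledTransform` (HypersurfaceRestriction), res-L1-w45b-stub-3's
`nonempty_iso_subscheme_comap_ker_symm` (…NatStrictTransformCentre, p515745).
-/

set_option linter.dupNamespace false -- mandated namespace `Summit.<Summit>.<Problem>` of this single-conjunct summit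

noncomputable section

open CategoryTheory CategoryTheory.Limits AlgebraicGeometry TopologicalSpace Topology IsLocalRing
open Literature.AlgebraicGeometry.Resolution
open AlgebraicGeometry.Scheme.IdealSheafData

namespace Summit.ResolutionOfSingularities.ResolutionOfSingularities.Cruxes.EquisingularLiftNat.Sections

/-! ## Ring lemma: the saturation of a principal ideal by a prime element is principal -/

/-- In a domain, if `r · tᵏ = b · h` with `t` prime and `t ∤ h`, then `h ∣ r` (peel off the powers of `t` one at a time).
[folklore] -/
theorem dvd_of_mul_pow_eq_mul_of_prime {R : Type*} [CommRing R] [IsDomain R] {t h : R} (ht : Prime t) (hth : ¬ t ∣ h) :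
    ∀ (k : ℕ) (r b : R), r * t ^ k = b * h → h ∣ r := by
  intro k
  induction k with
  | zero =>
    intro r b hrb
    rw [pow_zero, mul_one] at hrb
    exact ⟨b, by rw [hrb, mul_comm]⟩
  | succ k ih =>
    intro r b hrb
    -- `t ∣ b · h`, hence `t ∣ b`
    have htb : t ∣ b * h := ⟨r * t ^ k, by rw [← hrb]; ring⟩
    rcases ht.dvd_or_dvd htb with htb' | hth'
    · obtain ⟨b', rfl⟩ := htb'
      apply ih r b'
      have h1 : t * (r * t ^ k) = t * (b' * h) := by
        calc t * (r * t ^ k) = r * t ^ (k + 1) := by ring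
          _ = t * b' * h := hrb
          _ = t * (b' * h) := by ring
      exact mul_left_cancel₀ ht.ne_zero h1
    · exact absurd hth' hth

/-- **The saturation `⋃ₙ ((g) : tⁿ)` of a principal ideal by a PRIME element is principal** (in a domain with the ascending
chain condition on principal ideals, e.g. a Noetherian domain): if `g = 0` it is `0`; otherwise write `g = tᵐ · h` with `t ∤ h`
(`WfDvdMonoid.max_power_factor'`), and the saturation is `(h)`. [folklore] -/
theorem isPrincipal_iSup_colon_span_singleton_pow {R : Type*} [CommRing R] [IsDomain R] [WfDvdMonoid R]
    {t : R} (ht : Prime t) (g : R) :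
    (⨆ n : ℕ, Submodule.colon (Ideal.span {g}) ((Ideal.span {t} ^ n : Ideal R) : Set R)).IsPrincipal := by
  by_cases hg0 : g = 0
  · subst hg0
    refine ⟨⟨0, ?_⟩⟩
    show (⨆ n : ℕ, Submodule.colon (Ideal.span {(0 : R)}) ((Ideal.span {t} ^ n : Ideal R) : Set R)) = Ideal.span {0}
    rw [Ideal.span_singleton_zero]
    refine le_antisymm (iSup_le fun n => ?_) bot_le
    intro r hr
    rw [Submodule.mem_colon] at hr
    have h := hr (t ^ n) (by rw [Ideal.span_singleton_pow]; exact Ideal.mem_span_singleton_self _)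
    rw [smul_eq_mul, Ideal.mem_bot] at h
    rw [Ideal.mem_bot]
    rcases mul_eq_zero.mp h with h | h
    · exact h
    · exact absurd (pow_eq_zero_iff'.mp h).1 ht.ne_zero
  · obtain ⟨m, h, hth, hg⟩ := WfDvdMonoid.max_power_factor' hg0 ht.not_unit
    refine ⟨⟨h, ?_⟩⟩
    show (⨆ n : ℕ, Submodule.colon (Ideal.span {g}) ((Ideal.span {t} ^ n : Ideal R) : Set R)) = Ideal.span {h}
    apply le_antisymm
    · refine iSup_le fun n => ?_
      intro r hr
      rw [Submodule.mem_colon] at hr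
      have h1 := hr (t ^ n) (by rw [Ideal.span_singleton_pow]; exact Ideal.mem_span_singleton_self _)
      rw [smul_eq_mul, Ideal.mem_span_singleton'] at h1
      obtain ⟨a, ha⟩ := h1
      rw [Ideal.mem_span_singleton]
      refine dvd_of_mul_pow_eq_mul_of_prime ht hth n r (a * t ^ m) ?_
      rw [← ha, hg]; ring
    · rw [Ideal.span_singleton_le_iff_mem]
      refine Submodule.mem_iSup_of_mem m ?_
      rw [Submodule.mem_colon]
      intro s hs
      rw [Ideal.span_singleton_pow, SetLike.mem_coe, Ideal.mem_span_singleton'] at hs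
      obtain ⟨a, rfl⟩ := hs
      rw [smul_eq_mul, Ideal.mem_span_singleton']
      exact ⟨a, by rw [hg]; ring⟩

/-! ## The exceptional stalk is generated by a prime element -/

/-- **The stalk of the exceptional ideal at a point of the exceptional divisor is generated by a PRIME element.** For a
blow-up `τ : X′ → X` of a regular locally Noetherian `X` along `C` with `V(C)` regular: the exceptional divisor
`E = V(C·𝒪_{X′})` is regular (Liu 8.1.19 (b), tree `IsBlowup.isRegular_subscheme_comap`), so `𝒪_{X′,z′}/(t) = 𝒪_{E,z′}` is a
regular local ring, hence a domain, and `t ≠ 0` is prime. [cite: Liu2002, Thm. 8.1.19 (b)] -/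
theorem prime_of_stalkIdeal_exceptional_eq_span {X X' : Scheme.{0}} [IsLocallyNoetherian X] {τ : X' ⟶ X}
    {C : X.IdealSheafData} (hX : Scheme.IsRegular X) (hC : Scheme.IsRegular C.subscheme) (hτ : IsBlowup τ C)
    {z' : X'} (hz' : z' ∈ (C.comap τ).support) {t : X'.presheaf.stalk z'}
    (ht : stalkIdeal (C.comap τ) z' = Ideal.span {t}) (ht0 : t ≠ 0) : Prime t := by
  haveI : IsProper τ := hτ.isProper
  haveI : IsLocallyNoetherian X' := LocallyOfFiniteType.isLocallyNoetherian τ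
  have hE : Scheme.IsRegular (C.comap τ).subscheme := hτ.isRegular_subscheme_comap hX hC
  have hreg : IsRegularLocalRing (X'.presheaf.stalk z' ⧸ Ideal.span {t}) := by
    rw [← ht]; exact isRegularLocalRing_stalk_quotient_stalkIdeal hE hz'
  haveI : IsDomain (X'.presheaf.stalk z' ⧸ Ideal.span {t}) :=
    isDomain_of_isRegularLocalRing (X'.presheaf.stalk z' ⧸ Ideal.span {t})
  exact (Ideal.span_singleton_prime ht0).mp ((Ideal.Quotient.isDomain_iff_prime _).mp ‹_›)

/-! ## Strict transforms of stalkwise principal ideal sheaves are stalkwise principal -/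

/-- **`St_τ K` is stalkwise principal when `K` is** — for a blow-up `τ : X′ → X` of a regular, integral, locally Noetherian
`X` along `C ≠ ⊥` with `V(C)` regular. Off the exceptional divisor the strict transform is the total transform
`K_{τz′}·𝒪_{X′,z′}` (tree `stalkIdeal_strictTransformIdeal_of_not_mem`); at a point of the exceptional divisor it is the
saturation `⋃ₙ ((g) : tⁿ)` (tree `stalkIdeal_strictTransformIdeal`) of the principal total transform by the prime
exceptional generator `t` in the Noetherian local domain `𝒪_{X′,z′}` (`isPrincipal_iSup_colon_span_singleton_pow`).
[folklore; cf. GortzWedhorn2020 (13.19)] -/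
theorem isPrincipal_stalkIdeal_strictTransformIdeal {X X' : Scheme.{0}} [IsLocallyNoetherian X] [IsIntegral X]
    {τ : X' ⟶ X} {C : X.IdealSheafData} (hX : Scheme.IsRegular X) (hC : Scheme.IsRegular C.subscheme)
    (hτ : IsBlowup τ C) (hC0 : C ≠ ⊥) (K : X.IdealSheafData) (hK : ∀ z : X, (stalkIdeal K z).IsPrincipal)
    (z' : X') : (stalkIdeal (strictTransformIdeal τ C K) z').IsPrincipal := by
  haveI : IsProper τ := hτ.isProper
  haveI : IsLocallyNoetherian X' := LocallyOfFiniteType.isLocallyNoetherian τ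
  haveI : IsIntegral X' := hτ.isIntegral hC0
  obtain ⟨g, hg⟩ := (hK (τ z')).principal
  have hg' : stalkIdeal K (τ z') = Ideal.span {g} := hg
  by_cases hz' : z' ∈ (C.comap τ).support
  · -- on the exceptional divisor: saturation by the prime generator
    obtain ⟨t, htnz, ht⟩ := hτ.isEffectiveCartier.exists_stalkIdeal_eq_span z'
    have ht0 : t ≠ 0 := nonZeroDivisors.ne_zero htnz
    have hprime : Prime t := prime_of_stalkIdeal_exceptional_eq_span hX hC hτ hz' ht ht0
    rw [stalkIdeal_strictTransformIdeal τ C K z', hg', Ideal.map_span, Set.image_singleton, ht]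
    exact isPrincipal_iSup_colon_span_singleton_pow hprime _
  · -- off the exceptional divisor: the total transform
    rw [stalkIdeal_strictTransformIdeal_of_not_mem τ C K hz', hg', Ideal.map_span, Set.image_singleton]
    exact ⟨⟨_, rfl⟩⟩

/-! ## Clause (iii) gives order-one generators (the tree's «regular hypersurface» form) -/

/-- On an INTEGRAL scheme a non-zero ideal sheaf has non-zero stalks. [folklore] -/
theorem stalkIdeal_ne_bot_of_ne_bot {X : Scheme.{0}} [IsIntegral X] {𝓢 : X.IdealSheafData} (h𝓢0 : 𝓢 ≠ ⊥) (x : X) :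
    stalkIdeal 𝓢 x ≠ ⊥ := by
  intro h
  apply h𝓢0
  rw [← Scheme.IdealSheafData.support_eq_top_iff]
  exact TopologicalSpace.Closeds.ext (by
    rw [TopologicalSpace.Closeds.coe_top]; exact support_eq_top_of_stalkIdeal_eq_bot 𝓢 h)

/-- **Clause (iii) ⇒ order-one generators.** On a regular, integral, locally Noetherian `X`, an ideal sheaf `𝓢 ≠ ⊥` with
`V(𝓢)` regular and principal stalks is generated, at every point of `V(𝓢)`, by an element of order exactly one:
`𝒪_{X,x}/(v)` is regular and `v ≠ 0`, so `v ∉ 𝔪²` (Matsumura 14.2, tree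
`not_isRegularLocalRing_quotient_span_singleton_of_mem_sq`). [cite: Matsumura1987, Thm. 14.2] -/
theorem exists_generator_not_mem_sq_of_isRegular_subscheme {X : Scheme.{0}} [IsLocallyNoetherian X] [IsIntegral X]
    (hX : Scheme.IsRegular X) {𝓢 : X.IdealSheafData} (h𝓢reg : Scheme.IsRegular 𝓢.subscheme)
    (h𝓢pr : ∀ z : X, (stalkIdeal 𝓢 z).IsPrincipal) (h𝓢0 : 𝓢 ≠ ⊥) :
    ∀ x ∈ 𝓢.support, ∃ v : X.presheaf.stalk x,
      stalkIdeal 𝓢 x = Ideal.span {v} ∧ v ∉ (maximalIdeal (X.presheaf.stalk x)) ^ 2 := by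
  intro x hx
  obtain ⟨v, hv⟩ := (h𝓢pr x).principal
  have hv' : stalkIdeal 𝓢 x = Ideal.span {v} := hv
  have hv0 : v ≠ 0 := by
    rintro rfl
    exact stalkIdeal_ne_bot_of_ne_bot h𝓢0 x (by rw [hv', Ideal.span_singleton_zero])
  haveI := hX x
  have hq : IsRegularLocalRing (X.presheaf.stalk x ⧸ Ideal.span {v}) := by
    rw [← hv']; exact isRegularLocalRing_stalk_quotient_stalkIdeal h𝓢reg hx
  exact ⟨v, hv', fun h2 => not_isRegularLocalRing_quotient_span_singleton_of_mem_sq hv0 h2 hq⟩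

/-! ## `V(St_τ 𝓢)` is regular for a regular stalkwise-principal `𝓢 ≤ C` -/

/-- **The centre of `V(St 𝓢) → V(𝓢)` is `V(C)` itself**: for `𝓢 ≤ C` the closed subscheme `V(C·𝒪_{V(𝓢)}) ⊆ V(𝓢)` is
isomorphic to `V(𝓢·𝒪_{V(C)}) = V(C)` (symmetry of the scheme-theoretic intersection, res-L1-w45b-stub-3's
`nonempty_iso_subscheme_comap_ker_symm`, and `𝓢·𝒪_{V(C)} = 0`), hence regular when `V(C)` is. [folklore] -/
theorem isRegular_subscheme_comap_subschemeι_of_le {X : Scheme.{0}} {𝓢 C : X.IdealSheafData} (h𝓢C : 𝓢 ≤ C)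
    (hC : Scheme.IsRegular C.subscheme) : Scheme.IsRegular (C.comap 𝓢.subschemeι).subscheme := by
  have h0 : 𝓢.subschemeι.ker.comap C.subschemeι = ⊥ := by
    rw [Scheme.IdealSheafData.ker_subschemeι]
    exact le_bot_iff.mp ((Scheme.IdealSheafData.comap_mono (f := C.subschemeι) h𝓢C).trans
      (comap_subschemeι_self C).le)
  have h1 : Scheme.IsRegular (𝓢.subschemeι.ker.comap C.subschemeι).subscheme := by
    rw [h0]
    exact Scheme.IsRegular.of_isOpenImmersion (⊥ : C.subscheme.IdealSheafData).subschemeι hC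
  obtain ⟨e⟩ := Theorems.EquisingularLiftNat.CombCentre.nonempty_iso_subscheme_comap_ker_symm 𝓢.subschemeι C.subschemeι
  have h2 : Scheme.IsRegular (C.subschemeι.ker.comap 𝓢.subschemeι).subscheme :=
    Scheme.IsRegular.of_isOpenImmersion e.hom h1
  rwa [Scheme.IdealSheafData.ker_subschemeι] at h2

/-- **`V(St_τ 𝓢)` is regular.** Let `τ : X′ → X` be a blow-up of the regular, integral, locally Noetherian `X` along `C` with
`V(C)` regular, and `𝓢 ≤ C` a non-zero ideal sheaf with `V(𝓢)` regular and principal stalks (a regular hypersurface through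
the centre). Then the closed subscheme of the strict transform `St_τ 𝓢 = ⋃ₙ (τ^*𝓢 : 𝓘(E)ⁿ)` is REGULAR: `St_τ 𝓢` is the
controlled transform `(τ^*𝓢 : 𝓘(E))` (GW 13.96 (2)), `V(St_τ 𝓢) → V(𝓢)` is a blow-up of `V(𝓢)` along `C·𝒪_{V(𝓢)}` (BGMW §4
Remark (3)) and its centre `≅ V(C)` is regular, so Liu 8.1.19 (a) applies. [cite: Liu2002, Thm. 8.1.19 (a); GortzWedhorn2020,
Prop. 13.96 (2)] -/
theorem isRegular_subscheme_strictTransformIdeal_of_le {X X' : Scheme.{0}} [IsLocallyNoetherian X] [IsIntegral X]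
    {τ : X' ⟶ X} {C : X.IdealSheafData} (hX : Scheme.IsRegular X) (hC : Scheme.IsRegular C.subscheme)
    (hτ : IsBlowup τ C) (𝓢 : X.IdealSheafData) (h𝓢C : 𝓢 ≤ C) (h𝓢reg : Scheme.IsRegular 𝓢.subscheme)
    (h𝓢pr : ∀ z : X, (stalkIdeal 𝓢 z).IsPrincipal) (h𝓢0 : 𝓢 ≠ ⊥) :
    Scheme.IsRegular (strictTransformIdeal τ C 𝓢).subscheme := by
  have hH := exists_generator_not_mem_sq_of_isRegular_subscheme hX h𝓢reg h𝓢pr h𝓢0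
  rw [hτ.strictTransformIdeal_eq_controlledTransform_of_hypersurface hX hC h𝓢C hH]
  obtain ⟨πS, hπS⟩ := exists_hom_subscheme_controlledTransform τ C 𝓢
  have hbl : IsBlowup πS (C.comap 𝓢.subschemeι) := hτ.isBlowup_subscheme_controlledTransform hX hC h𝓢C hH πS hπS
  haveI : IsLocallyNoetherian 𝓢.subscheme := LocallyOfFiniteType.isLocallyNoetherian 𝓢.subschemeι
  exact hbl.isRegular_of_isRegular_subscheme h𝓢reg (isRegular_subscheme_comap_subschemeι_of_le h𝓢C hC)

/-! ## `St_τ 𝓢 ≠ ⊥` (the hypotheses reproduce themselves along the inner chain) -/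

/-- **The strict transform of a non-zero ideal sheaf is non-zero** (blow-up `τ` of an integral `X` along `C ≠ ⊥`): it contains
the total transform `τ^*𝓢`, whose support would otherwise contain the dense open `τ⁻¹(X ∖ V(C)) ≅ X ∖ V(C)`, forcing
`V(𝓢) = X`, i.e. `𝓢 = 0`. [folklore] -/
theorem strictTransformIdeal_ne_bot {X X' : Scheme.{0}} [IsLocallyNoetherian X] [IsIntegral X] {τ : X' ⟶ X} {C : X.IdealSheafData}
    (hτ : IsBlowup τ C) (hC0 : C ≠ ⊥) {𝓢 : X.IdealSheafData} (h𝓢0 : 𝓢 ≠ ⊥) : strictTransformIdeal τ C 𝓢 ≠ ⊥ := by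
  haveI : IsProper τ := hτ.isProper
  haveI : IsIntegral X' := hτ.isIntegral hC0
  intro hSt
  -- the total transform vanishes
  have htot : 𝓢.comap τ = ⊥ :=
    le_bot_iff.mp ((comap_le_controlledTransform τ C 𝓢 1).trans
      ((controlledTransform_le_strictTransformIdeal τ C 𝓢 1).trans hSt.le))
  have hsupp : ((𝓢.comap τ).support : Set X') = Set.univ := by
    rw [Scheme.IdealSheafData.support_eq_top_iff.mpr htot]; rfl
  rw [Scheme.IdealSheafData.support_comap, TopologicalSpace.Closeds.coe_preimage] at hsupp
  -- the open complement of the centre is non-empty and lies in `V(𝓢)`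
  apply h𝓢0
  rw [← Scheme.IdealSheafData.support_eq_top_iff]
  apply TopologicalSpace.Closeds.ext
  rw [TopologicalSpace.Closeds.coe_top]
  haveI : IsIso (τ ∣_ centreCompl C) := hτ.isIso_compl
  have hUsub : ((centreCompl C : X.Opens) : Set X) ⊆ (𝓢.support : Set X) := by
    intro x hx
    obtain ⟨z, hz⟩ := (τ ∣_ centreCompl C).surjective ⟨x, hx⟩
    have hz' : τ z.1 = x := by
      have h := morphismRestrict_base_coe τ (centreCompl C) z
      rw [hz] at h
      exact h.symm
    have hmem : z.1 ∈ (τ : X' → X) ⁻¹' (𝓢.support : Set X) := by rw [hsupp]; trivial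
    rw [← hz']; exact hmem
  have hdense : Dense ((centreCompl C : X.Opens) : Set X) :=
    (centreCompl C).2.dense (centreCompl_nonempty hC0)
  exact Set.eq_univ_of_univ_subset (hdense.closure_eq ▸ closure_minimal hUsub 𝓢.support.isClosed)

/-! ## The package: clause (iii) of `TCPlus.Member` after the step -/

/-- **K7d — clause (iii) of `TCPlus.Member` carried along a blow-up in a regular centre.** `X` regular, integral, locally
Noetherian; `τ : X′ → X` a blow-up along `C` with `V(C)` regular; an in-carrier pair `(𝓢, K)` with `𝓢 ≤ C`, `𝓢 ≠ ⊥` and clause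
(iii) `Scheme.IsRegular 𝓢.subscheme ∧ ∀ z, (stalkIdeal 𝓢 z).IsPrincipal ∧ (stalkIdeal K z).IsPrincipal`. Then clause (iii)
holds VERBATIM for the pair `(St_τ 𝓢, St_τ K)` on `X′`, and `St_τ 𝓢 ≠ ⊥`. [OURS · L1 W4.5b] toward
`stub_elnat_tcPlusPointResolution` (HSUB(ReachTC⁺)₃ brick K7d); NOT a statement of the manuscript. -/
theorem member_clause_iii_strictTransform {X X' : AlgebraicGeometry.Scheme.{0}} [AlgebraicGeometry.IsLocallyNoetherian X]
    [AlgebraicGeometry.IsIntegral X] {τ : X' ⟶ X} {C : X.IdealSheafData}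
    (hX : Literature.AlgebraicGeometry.Resolution.Scheme.IsRegular X)
    (hC : Literature.AlgebraicGeometry.Resolution.Scheme.IsRegular C.subscheme)
    (hτ : Literature.AlgebraicGeometry.Resolution.IsBlowup τ C) (𝓢 K : X.IdealSheafData) (h𝓢C : 𝓢 ≤ C) (h𝓢0 : 𝓢 ≠ ⊥)
    (hiii : Literature.AlgebraicGeometry.Resolution.Scheme.IsRegular 𝓢.subscheme ∧
      ∀ z : X, (stalkIdeal 𝓢 z).IsPrincipal ∧ (stalkIdeal K z).IsPrincipal) :
    (Literature.AlgebraicGeometry.Resolution.Scheme.IsRegular (strictTransformIdeal τ C 𝓢).subscheme ∧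
      ∀ z : X', (stalkIdeal (strictTransformIdeal τ C 𝓢) z).IsPrincipal ∧
        (stalkIdeal (strictTransformIdeal τ C K) z).IsPrincipal) ∧
    strictTransformIdeal τ C 𝓢 ≠ ⊥ := by
  have hC0 : C ≠ ⊥ := fun h => h𝓢0 (le_bot_iff.mp (h ▸ h𝓢C))
  refine ⟨⟨isRegular_subscheme_strictTransformIdeal_of_le hX hC hτ 𝓢 h𝓢C hiii.1 (fun z => (hiii.2 z).1) h𝓢0,
    fun z => ⟨isPrincipal_stalkIdeal_strictTransformIdeal hX hC hτ hC0 𝓢 (fun z => (hiii.2 z).1) z,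
      isPrincipal_stalkIdeal_strictTransformIdeal hX hC hτ hC0 K (fun z => (hiii.2 z).2) z⟩⟩,
    strictTransformIdeal_ne_bot hτ hC0 h𝓢0⟩


/-- **K7d at a SECTION centre** (the shape of the HSUB′ steps). For a separated morphism `r : X → Spec O` to the spectrum of a
DVR and a section `s` (`s ≫ r = 𝟙`), the centre `V(ker s) ≅ Spec O` is regular (res-D-pv-029's
`section_isClosedImmersion_and_isRegular_ker`); with `𝓢 ⊔ K ≤ s.ker` the package `member_clause_iii_strictTransform` applies to
any blow-up `τ` of `X` along `s.ker`. [OURS · L1 W4.5b] toward `stub_elnat_tcPlusPointResolution` (HSUB(ReachTC⁺)₃ brick K7d);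
NOT a statement of the manuscript. -/
theorem member_clause_iii_strictTransform_section (O : Type) [CommRing O] [IsDomain O] [IsDiscreteValuationRing O]
    {X X' : AlgebraicGeometry.Scheme.{0}} [AlgebraicGeometry.IsLocallyNoetherian X] [AlgebraicGeometry.IsIntegral X]
    (r : X ⟶ AlgebraicGeometry.Spec (.of O)) [AlgebraicGeometry.IsSeparated r] (s : AlgebraicGeometry.Spec (.of O) ⟶ X)
    (hs : CategoryTheory.CategoryStruct.comp s r = CategoryTheory.CategoryStruct.id _)
    (hX : Literature.AlgebraicGeometry.Resolution.Scheme.IsRegular X) {τ : X' ⟶ X}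
    (hτ : Literature.AlgebraicGeometry.Resolution.IsBlowup τ s.ker) (𝓢 K : X.IdealSheafData) (h𝓢K : 𝓢 ⊔ K ≤ s.ker)
    (h𝓢0 : 𝓢 ≠ ⊥)
    (hiii : Literature.AlgebraicGeometry.Resolution.Scheme.IsRegular 𝓢.subscheme ∧
      ∀ z : X, (stalkIdeal 𝓢 z).IsPrincipal ∧ (stalkIdeal K z).IsPrincipal) :
    (Literature.AlgebraicGeometry.Resolution.Scheme.IsRegular (strictTransformIdeal τ s.ker 𝓢).subscheme ∧
      ∀ z : X', (stalkIdeal (strictTransformIdeal τ s.ker 𝓢) z).IsPrincipal ∧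
        (stalkIdeal (strictTransformIdeal τ s.ker K) z).IsPrincipal) ∧
    strictTransformIdeal τ s.ker 𝓢 ≠ ⊥ := by
  obtain ⟨-, hC, -, -⟩ := EquisingularLift.StrataSplit.section_isClosedImmersion_and_isRegular_ker O X r s hs
  exact member_clause_iii_strictTransform hX hC hτ 𝓢 K (le_sup_left.trans h𝓢K) h𝓢0 hiii

end Summit.ResolutionOfSingularities.ResolutionOfSingularities.Cruxes.EquisingularLiftNat.Sections

end
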